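import Summits.Ventures.HodgeRepro2.T5HeckeStar
import Summits.Ventures.HodgeRepro2.T5HeckeAdjoint
import Summits.Ventures.HodgeRepro2.T5HeckeMatrixCoefficient

/-!
# `π(f)^* = π(f^*)`: Hecke operators are adjoint under the star for an invariant hermitian form

For a `G`-invariant hermitian form `B` on a representation `π` (the unitary structure of a unitary
representation: conjugate-linear in the first slot, `B(v, w) = \overline{B(w, v)}`,
`B(π(g)v, π(g)w) = B(v, w)`) and `K`-fixed `v, w`,

  `B(T • v, w) = B(v, T^* • w)`   (`apply_heckeSMul_eq_apply_heckeSMul_starOp`)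

for every `T ∈ H(G, K)`, with `T^* = starOp T` the star of `T5HeckeStar` (`f^*(g) = \overline{f(g⁻¹)}`),
provided `#(Kg⁻¹K/K) = #(KgK/K)` for all `g` (unimodularity, `T5HaarDoubleCosetInverse`).  In
particular `T_g^* = T_{g⁻¹}` as operators on `π^K`, and for a commutative `H(G, K)` the Hecke
operators are normal.  Proof: both sides are conjugate-linear in `T`; on the double-coset basis the
identity is `T5HeckeMatrixCoefficient` applied to the `K`-fixed functionals `B(w, ·)` and `B(v, ·)`.
-/

namespace Summit.Ventures.HodgeRepro2.T5HeckeAdjointHermitian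

open T5HeckePermutationModule T5HeckeDoubleCoset T5HeckeDoubleCosetBasis T5HeckeConvolution
  T5HeckeTranspose T5HeckeStar T5HeckeMatrixCoefficient LevelPositivity

variable {G : Type*} [Group G] {k : Type*} [Field k] [StarRing k] {V : Type*} [AddCommGroup V]
  [Module k V] (ρ : Representation k G V) {K : Subgroup G}

/-- A `G`-invariant sesquilinear form (conjugate-linear in the first slot). -/
def IsInvariantSesq (B : V →ₗ⋆[k] V →ₗ[k] k) : Prop :=
  ∀ (g : G) (v w : V), B (ρ g v) (ρ g w) = B v w

/-- A hermitian form: `B(v, w) = \overline{B(w, v)}`. -/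
def IsHermitian (B : V →ₗ⋆[k] V →ₗ[k] k) : Prop :=
  ∀ v w : V, B v w = star (B w v)

variable {ρ}

/-- For an invariant form and `K`-fixed `v`, the linear functional `B(v, ·)` is `K`-fixed in the
dual representation. -/
theorem apply_mem_invariants_dual {B : V →ₗ⋆[k] V →ₗ[k] k} (hB : IsInvariantSesq ρ B) {v : V}
    (hv : v ∈ invariants ρ K) : B v ∈ invariants ρ.dual K := by
  rw [mem_invariants_iff]
  intro κ hκ
  ext u
  rw [Representation.dual_apply, Module.Dual.transpose_apply, LinearMap.comp_apply]
  conv_rhs => rw [← hB κ⁻¹ v u]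
  rw [mem_invariants_iff.1 hv κ⁻¹ (K.inv_mem hκ)]

/-- `T ↦ B(T • v, w)` is conjugate-linear on `H(G, K)`. -/
noncomputable def pairLeft (B : V →ₗ⋆[k] V →ₗ[k] k) (v : invariants ρ K) (w : V) :
    heckeAlgebra k K →ₛₗ[starRingEnd k] k where
  toFun T := B (heckeSMul ρ T v) w
  map_add' T T' := by
    rw [heckeSMul_add_left, Submodule.coe_add, map_add, LinearMap.add_apply]
  map_smul' c T := by
    rw [heckeSMul_smul_left, Submodule.coe_smul, LinearMap.map_smulₛₗ, LinearMap.smul_apply,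
      smul_eq_mul]

/-- `T ↦ B(v, T^* • w)` is conjugate-linear on `H(G, K)`. -/
noncomputable def pairRight (hK : ∀ g : G, Finite (MulAction.orbit K (g : G ⧸ K)))
    (B : V →ₗ⋆[k] V →ₗ[k] k) (v : V) (w : invariants ρ K) :
    heckeAlgebra k K →ₛₗ[starRingEnd k] k where
  toFun T := B v (heckeSMul ρ (starOp hK T) w)
  map_add' T T' := by
    rw [starOp_add, heckeSMul_add_left, Submodule.coe_add, map_add]
  map_smul' c T := by
    rw [starOp_smul, heckeSMul_smul_left, Submodule.coe_smul, map_smul, starRingEnd_apply]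

/-- THE ADJOINT IDENTITY ON A DOUBLE COSET: `B(T_g • v, w) = B(v, T_{g⁻¹} • w)` for an invariant
hermitian form, when `#(Kg⁻¹K/K) = #(KgK/K)`. -/
theorem apply_heckeSMul_doubleCosetOp_eq (hK : ∀ g : G, Finite (MulAction.orbit K (g : G ⧸ K)))
    {B : V →ₗ⋆[k] V →ₗ[k] k} (hB : IsInvariantSesq ρ B) (hH : IsHermitian B) (g : G)
    [Finite (MulAction.orbit K (g : G ⧸ K))]
    (hU : (MulAction.orbit K ((g⁻¹ : G) : G ⧸ K)).ncard = (MulAction.orbit K (g : G ⧸ K)).ncard)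
    (v w : invariants ρ K) :
    pairLeft B v w (doubleCosetOp k K g) = pairRight hK B v w (doubleCosetOp k K g) := by
  haveI := hK g⁻¹
  show B (heckeSMul ρ (doubleCosetOp k K g) v) w =
    B v (heckeSMul ρ (starOp hK (doubleCosetOp k K g)) w)
  have h₁ := apply_heckeSMul_doubleCosetOp ρ (apply_mem_invariants_dual hB w.2) g v
  have h₂ := apply_heckeSMul_doubleCosetOp ρ (apply_mem_invariants_dual hB v.2) g⁻¹ w
  rw [hH, h₁, starOp_doubleCosetOp, h₂, hU, star_mul', star_natCast, ← hH]
  congr 1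
  conv_rhs => rw [← hB g v (ρ g⁻¹ w)]
  rw [← Module.End.mul_apply, ← map_mul, mul_inv_cancel, map_one, Module.End.one_apply]

/-- `π(f)^* = π(f^*)`: for `K`-fixed `v, w`, an invariant hermitian form `B` and every
`T ∈ H(G, K)`, `B(T • v, w) = B(v, starOp T • w)`, provided `#(Kg⁻¹K/K) = #(KgK/K)` for all `g`. -/
theorem apply_heckeSMul_eq_apply_heckeSMul_starOp
    (hK : ∀ g : G, Finite (MulAction.orbit K (g : G ⧸ K)))
    (hU : ∀ g : G, (MulAction.orbit K ((g⁻¹ : G) : G ⧸ K)).ncard =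
      (MulAction.orbit K (g : G ⧸ K)).ncard)
    {B : V →ₗ⋆[k] V →ₗ[k] k} (hB : IsInvariantSesq ρ B) (hH : IsHermitian B)
    (T : heckeAlgebra k K) (v w : invariants ρ K) :
    B (heckeSMul ρ T v) w = B v (heckeSMul ρ (starOp hK T) w) := by
  have h : pairLeft B v (w : V) = pairRight hK B (v : V) w := by
    apply Module.Basis.ext (heckeAlgebraBasis k K)
    intro ω
    rw [T5HeckeAdjoint.heckeAlgebraBasis_eq_doubleCosetOp]
    haveI := T5HeckeAdjoint.finite_orbit_out_out ω
    exact apply_heckeSMul_doubleCosetOp_eq hK hB hH _ (hU _) v w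
  exact LinearMap.congr_fun h T

/-- The double-coset operators `T_g` and `T_{g⁻¹}` are adjoint for an invariant hermitian form. -/
theorem apply_heckeSMul_doubleCosetOp_eq_apply_heckeSMul_doubleCosetOp_inv
    (hK : ∀ g : G, Finite (MulAction.orbit K (g : G ⧸ K)))
    {B : V →ₗ⋆[k] V →ₗ[k] k} (hB : IsInvariantSesq ρ B) (hH : IsHermitian B) (g : G)
    [Finite (MulAction.orbit K (g : G ⧸ K))] [Finite (MulAction.orbit K ((g⁻¹ : G) : G ⧸ K))]
    (hU : (MulAction.orbit K ((g⁻¹ : G) : G ⧸ K)).ncard = (MulAction.orbit K (g : G ⧸ K)).ncard)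
    (v w : invariants ρ K) :
    B (heckeSMul ρ (doubleCosetOp k K g) v) w = B v (heckeSMul ρ (doubleCosetOp k K g⁻¹) w) := by
  have h := apply_heckeSMul_doubleCosetOp_eq hK hB hH g hU v w
  rw [show pairLeft B v (w : V) (doubleCosetOp k K g) = B (heckeSMul ρ (doubleCosetOp k K g) v) w
    from rfl, show pairRight hK B (v : V) w (doubleCosetOp k K g) =
      B v (heckeSMul ρ (starOp hK (doubleCosetOp k K g)) w) from rfl,
    starOp_doubleCosetOp] at h
  exact h

end Summit.Ventures.HodgeRepro2.T5HeckeAdjointHermitian
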